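import Literature.Probability.Percolation.QSMLiftDefs
import HarnessLib

/-!
# The lifted exploration on `ℤ³`: freshness, consistency and the lifted cluster
# (Martineau–Severo 2019, Proposition 4.1 for `ℤ³ → C_n □ ℤ²`)

Seventh file of the inline proof of `Literature.Probability.Percolation.martineauSevero_zd3_slabTorus`.
With the bookkeeping of `QSMLiftDefs.lean` we run the exploration of `QSMExploration.lean` with
coins read on `ℤ³` (`SlabTorus.encII`): an edge query reads the designated lift, a column bonus
reads the `8n` coins of `Dcol`. We prove:

* `SlabTorus.inv_lift` — the structural invariants of the replayed lift (heights project to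
  residues; a queried edge is `s(a, nbr a d)` for its recorded `(a, d) = src e` with `a`
  explored), `SlabTorus.inv_Y` (an attempted column has its base vertex explored and all its
  incident edges queried: Martineau–Severo's "complete round" before Step `2K+2`), and the frozenness
  of heights and designated lifts;
* `SlabTorus.goodEnc_II` — **freshness on `ℤ³`** (Martineau–Severo's Conditions 1–4: no coin is
  read twice): every coin read so far is a designated lift, a vertical edge over an attempted
  column, or a parity-`χ` horizontal edge over an attempted column (`Covered`), and a new probe
  avoids all three (designated lifts project to their own `ℋ`-edge; the parity trick for
  horizontal edges);
* `SlabTorus.reach_lift` — **the lifted cluster** (Martineau–Severo's Condition 3: "Every element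
  of `C'_{ℓ,n}` is connected to `o'` by an `η`-open path", and Proposition 4.1): along a run,
  the lift `λ(v)` of every explored vertex is joined to `0` by an open path of `ω`, so that the
  transcript event "a column of sup-norm `L + 1` was explored" implies that the open cluster of
  `0` in `ℤ³` contains a point whose planar projection has sup-norm `L + 1`
  (`SlabTorus.setOf_reachState_subset_far`).

## References

* S. Martineau, F. Severo, Ann. Probab. 47 (2019), §5 (Conditions 1–5, Steps `2K+1`, `2K+2`,
  Step ∞; Proposition 4.1) [MartineauSevero2019].
* I. Benjamini, O. Schramm, Electron. Comm. Probab. 1 (1996), Thm. 1 [BenjaminiSchramm1996].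
-/

set_option synthInstance.maxSize 1024

namespace Literature.Probability.Percolation

open LatticeModels MeasureTheory ProbeHistory

namespace SlabTorus

variable {n : ℕ} [NeZero n]

/-! ### Heights along a transcript -/

/-- Heights after a successful bonus of `y`: old vertices keep theirs, a newly conquered vertex
`(t, y')` of a neighbouring column is lifted to the far endpoint of the chosen horizontal lift.
[cite: MartineauSevero2019, §5 (C'_{2K+2,n+1})] -/
noncomputable def bonusHt (σ : HState n) (h : Vert n → ℤ) (y : Site 2) : Vert n → ℤ := fun v =>
  if v ∈ σ.A then h v
  else if (zdGraph 2).Adj y v.2 then baseHt h y + v.1.val + jstar σ h y v.1 (hdOf y v.2) * n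
  else h v

/-- **The heights of the lifts along a transcript** (Benjamini–Schramm's lift of the exploration
tree, with the bonus lifts of Martineau–Severo): the far endpoint of an open queried edge is lifted
through the designated lift of that edge. [cite: MartineauSevero2019, §5 (C'_{2K+1,n+1} := C' ∪ e')] -/
noncomputable def htOf (L : ℕ) : List Bool → Vert n → ℤ
  | [] => fun _ => 0
  | b :: bs => match nq L (stateOf (n := n) L bs) with
    | none => htOf L bs
    | some (Query.edge a d) =>
      if b = true ∧ nbr a d ∉ (stateOf (n := n) L bs).A then
        Function.update (htOf L bs) (nbr a d) (htOf L bs a + dvec d 0) else htOf L bs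
    | some (Query.col y) => if b = true then bonusHt (stateOf (n := n) L bs) (htOf L bs) y else htOf L bs

variable (L : ℕ)

/-- Unfolding `htOf` on a cons. [folklore] -/
theorem htOf_cons (b : Bool) (bs : List Bool) :
    htOf (n := n) L (b :: bs) = match nq L (stateOf (n := n) L bs) with
      | none => htOf L bs
      | some (Query.edge a d) =>
        if b = true ∧ nbr a d ∉ (stateOf (n := n) L bs).A then
          Function.update (htOf L bs) (nbr a d) (htOf L bs a + dvec d 0) else htOf L bs
      | some (Query.col y) => if b = true then bonusHt (stateOf (n := n) L bs) (htOf L bs) y else htOf L bs := rfl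

/-- **Heights of explored vertices are frozen.** [cite: MartineauSevero2019, §5] -/
theorem htOf_cons_of_mem (b : Bool) (bs : List Bool) {v : Vert n} (hv : v ∈ (stateOf (n := n) L bs).A) :
    htOf (n := n) L (b :: bs) v = htOf L bs v := by
  rw [htOf_cons]
  cases nq L (stateOf (n := n) L bs) with
  | none => rfl
  | some q =>
    cases q with
    | edge a d =>
      simp only
      split_ifs with h
      · rw [Function.update_of_ne]
        rintro rfl
        exact h.2 hv
      · rfl
    | col y =>
      simp only
      split_ifs
      · simp [bonusHt, hv]
      · rfl

/-- The recorded query data of a queried edge is frozen. [folklore] -/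
theorem src_cons_of_mem (b : Bool) (bs : List Bool) {e : Sym2 (Vert n)} (he : e ∈ (stateOf (n := n) L bs).Q) :
    (stateOf (n := n) L (b :: bs)).src e = (stateOf (n := n) L bs).src e := by
  rw [stateOf_cons]
  cases hq : nq L (stateOf (n := n) L bs) with
  | none => rfl
  | some q =>
    cases q with
    | edge a d =>
      obtain ⟨-, -, hQ⟩ := nq_edge_spec hq
      simp only [hstep]
      rw [Function.update_of_ne]
      rintro rfl
      exact hQ he
    | col y => rfl

/-- Queried edges stay queried. [folklore] -/
theorem Q_subset_Q_cons (b : Bool) (bs : List Bool) : (stateOf (n := n) L bs).Q ⊆ (stateOf (n := n) L (b :: bs)).Q := by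
  rw [stateOf_cons]
  cases nq L (stateOf (n := n) L bs) with
  | none => exact le_rfl
  | some q =>
    cases q with
    | edge a d => simp only [hstep]; exact Finset.subset_insert _ _
    | col y => exact le_rfl

/-- Attempted columns stay attempted. [folklore] -/
theorem Y_subset_Y_cons (b : Bool) (bs : List Bool) : (stateOf (n := n) L bs).Y ⊆ (stateOf (n := n) L (b :: bs)).Y := by
  rw [stateOf_cons]
  cases nq L (stateOf (n := n) L bs) with
  | none => exact le_rfl
  | some q =>
    cases q with
    | edge a d => exact le_rfl
    | col y => simp only [hstep]; exact Finset.subset_insert _ _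

/-- The column of an explored-open column is explored. [folklore] -/
theorem col_subset_A_of_colOpen {b : List Bool} {y : Site 2} (hopen : colOpen (stateOf (n := n) L b) y) (t : ZMod n) :
    ((t, y) : Vert n) ∈ (stateOf (n := n) L b).A := by
  obtain ⟨-, -, hO⟩ := inv_struct (n := n) L b
  obtain ⟨a, d, he, ha, hb⟩ := hO _ (hopen t)
  rcases (Sym2.eq_iff.1 he) with ⟨h1, -⟩ | ⟨h1, -⟩
  · rw [h1]; exact ha
  · rw [h1]; exact hb

/-- **Structural invariants of the lift** (every transcript): heights of explored vertices project
to their residues (`π(λ v) = v`), and a queried edge `e` is `s(a, nbr a d)` for its recorded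
`(a, d) = src e`, with `a` explored. [cite: MartineauSevero2019, §5 (Conditions 1, 5)] -/
theorem inv_lift (b : List Bool) :
    (∀ v ∈ (stateOf (n := n) L b).A, (((htOf (n := n) L b v : ℤ)) : ZMod n) = v.1) ∧
      (∀ e ∈ (stateOf (n := n) L b).Q, e = s(((stateOf (n := n) L b).src e).1,
        nbr ((stateOf (n := n) L b).src e).1 ((stateOf (n := n) L b).src e).2) ∧
        ((stateOf (n := n) L b).src e).1 ∈ (stateOf (n := n) L b).A) := by
  induction b with
  | nil =>
    refine ⟨fun v hv => ?_, fun e he => ?_⟩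
    · simp only [stateOf, HState.init, Finset.mem_singleton] at hv
      subst hv
      simp [htOf, origin]
    · simp [stateOf, HState.init] at he
  | cons a b ih =>
    obtain ⟨h1, h2⟩ := ih
    have hfr := fun v (hv : v ∈ (stateOf (n := n) L b).A) => htOf_cons_of_mem L a b hv
    have hsrc := fun e (he : e ∈ (stateOf (n := n) L b).Q) => src_cons_of_mem L a b he
    have hA := A_subset_A_cons (n := n) L a b
    have hAset : (stateOf (n := n) L (a :: b)).A = (match nq L (stateOf (n := n) L b) with
        | none => (stateOf (n := n) L b).A
        | some (Query.edge a' d) => if a then insert (nbr a' d) (stateOf (n := n) L b).A else (stateOf (n := n) L b).A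
        | some (Query.col y) => if a then (stateOf (n := n) L b).A ∪ nbhdVerts y else (stateOf (n := n) L b).A) := by
      rw [stateOf_cons]
      cases nq L (stateOf (n := n) L b) with
      | none => rfl
      | some q => cases q <;> rfl
    have hQset : (stateOf (n := n) L (a :: b)).Q = (match nq L (stateOf (n := n) L b) with
        | none => (stateOf (n := n) L b).Q
        | some (Query.edge a' d) => insert s(a', nbr a' d) (stateOf (n := n) L b).Q
        | some (Query.col _) => (stateOf (n := n) L b).Q) := by
      rw [stateOf_cons]
      cases nq L (stateOf (n := n) L b) with
      | none => rfl
      | some q => cases q <;> rfl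
    cases hq : nq L (stateOf (n := n) L b) with
    | none =>
      rw [hq] at hAset hQset
      refine ⟨fun v hv => ?_, fun e he => ?_⟩
      · rw [hAset] at hv; rw [hfr v hv]; exact h1 v hv
      · rw [hQset] at he
        rw [hsrc e he]
        exact ⟨(h2 e he).1, hA (h2 e he).2⟩
    | some q =>
      rw [hq] at hAset hQset
      cases q with
      | edge a' d =>
        obtain ⟨ha', -, hQ⟩ := nq_edge_spec hq
        simp only at hAset hQset
        refine ⟨fun v hv => ?_, fun e he => ?_⟩
        · by_cases hvA : v ∈ (stateOf (n := n) L b).A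
          · rw [hfr v hvA]; exact h1 v hvA
          · rw [hAset] at hv
            split_ifs at hv with ha
            · rcases Finset.mem_insert.1 hv with rfl | hv
              · rw [htOf_cons, hq]
                simp only [ha, true_and, hvA, not_false_eq_true, if_true, Function.update_self]
                push_cast
                rw [h1 a' ha', nbr]
              · exact absurd hv hvA
            · exact absurd hv hvA
        · rw [hQset] at he
          rcases Finset.mem_insert.1 he with rfl | he
          · have hs : (stateOf (n := n) L (a :: b)).src s(a', nbr a' d) = (a', d) := by
              rw [stateOf_cons, hq]; simp [hstep]
            rw [hs]
            exact ⟨rfl, hA ha'⟩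
          · rw [hsrc e he]
            exact ⟨(h2 e he).1, hA (h2 e he).2⟩
      | col y =>
        obtain ⟨-, -, -, hopen⟩ := nq_col_spec hq
        simp only at hAset hQset
        refine ⟨fun v hv => ?_, fun e he => ?_⟩
        · by_cases hvA : v ∈ (stateOf (n := n) L b).A
          · rw [hfr v hvA]; exact h1 v hvA
          · rw [hAset] at hv
            split_ifs at hv with ha
            · rcases Finset.mem_union.1 hv with hv | hv
              · exact absurd hv hvA
              · have hadj := mem_nbhdVerts_iff.1 hv
                rw [htOf_cons, hq]
                simp only [ha, if_true, bonusHt, hvA, if_false, hadj]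
                have h0 : ((0 : ZMod n), y) ∈ (stateOf (n := n) L b).A := col_subset_A_of_colOpen L hopen 0
                have hbase : (((baseHt (htOf (n := n) L b) y : ℤ)) : ZMod n) = 0 := h1 _ h0
                push_cast
                rw [hbase, ZMod.natCast_zmod_val, ZMod.natCast_self]
                ring
            · exact absurd hv hvA
        · rw [hQset] at he
          rw [hsrc e he]
          exact ⟨(h2 e he).1, hA (h2 e he).2⟩

/-- Along any transcript, designated lifts project to their edges. [cite: MartineauSevero2019, §5 (Condition 1)] -/
theorem piE_desig_stateOf (b : List Bool) {e : Sym2 (Vert n)} (he : e ∈ (stateOf (n := n) L b).Q) :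
    piE n (desig (stateOf (n := n) L b) (htOf (n := n) L b) e) = e := by
  obtain ⟨h1, h2⟩ := inv_lift (n := n) L b
  exact piE_desig (h2 e he).1 (h1 _ (h2 e he).2)

/-- The origin keeps height `0`. [folklore] -/
theorem htOf_origin (b : List Bool) : htOf (n := n) L b (origin n) = 0 := by
  induction b with
  | nil => rfl
  | cons a b ih => rw [htOf_cons_of_mem L a b (inv_struct (n := n) L b).1, ih]

/-- **Invariants of an attempted column** (the "complete round" before a bonus): its base vertex is
explored, its vertical edges are queried, and every edge of `E_L` at the column is queried.
[cite: MartineauSevero2019, §5 (Step 2K+2 happens after Step 2K+1 is finished)] -/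
theorem inv_Y (b : List Bool) {y : Site 2} (hy : y ∈ (stateOf (n := n) L b).Y) :
    ((0 : ZMod n), y) ∈ (stateOf (n := n) L b).A ∧
      (∀ t : ZMod n, s(((t, y) : Vert n), (t + 1, y)) ∈ (stateOf (n := n) L b).Q) ∧
      (∀ (t : ZMod n) (d : Dir), s(((t, y) : Vert n), nbr (t, y) d) ∈ KE n L →
        s(((t, y) : Vert n), nbr (t, y) d) ∈ (stateOf (n := n) L b).Q) := by
  induction b with
  | nil => simp [stateOf, HState.init] at hy
  | cons a b ih =>
    have hA := A_subset_A_cons (n := n) L a b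
    have hQ := Q_subset_Q_cons (n := n) L a b
    have hYset : (stateOf (n := n) L (a :: b)).Y = (match nq L (stateOf (n := n) L b) with
        | some (Query.col y') => insert y' (stateOf (n := n) L b).Y
        | _ => (stateOf (n := n) L b).Y) := by
      rw [stateOf_cons]
      cases nq L (stateOf (n := n) L b) with
      | none => rfl
      | some q => cases q <;> rfl
    rw [hYset] at hy
    have hold : y ∈ (stateOf (n := n) L b).Y → _ := fun hy =>
      let ⟨i1, i2, i3⟩ := ih hy
      (⟨hA i1, fun t => hQ (i2 t), fun t d he => hQ (i3 t d he)⟩ :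
        ((0 : ZMod n), y) ∈ (stateOf (n := n) L (a :: b)).A ∧
        (∀ t : ZMod n, s(((t, y) : Vert n), (t + 1, y)) ∈ (stateOf (n := n) L (a :: b)).Q) ∧
        (∀ (t : ZMod n) (d : Dir), s(((t, y) : Vert n), nbr (t, y) d) ∈ KE n L →
          s(((t, y) : Vert n), nbr (t, y) d) ∈ (stateOf (n := n) L (a :: b)).Q))
    cases hq : nq L (stateOf (n := n) L b) with
    | none => rw [hq] at hy; exact hold hy
    | some q =>
      rw [hq] at hy
      cases q with
      | edge a' d => exact hold hy
      | col y' =>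
        simp only at hy
        rcases Finset.mem_insert.1 hy with rfl | hy
        · obtain ⟨hnoedge, -, -, hopen⟩ := nq_col_spec hq
          obtain ⟨-, hOQ, -⟩ := inv_struct (n := n) L b
          have hcol := col_subset_A_of_colOpen L hopen
          refine ⟨hA (hcol 0), fun t => hQ (hOQ (hopen t)), fun t d he => hQ ?_⟩
          by_contra hne
          exact hnoedge ⟨((t, y), d), hcol t, he, hne⟩
        · exact hold hy

/-! ### The `ℤ³`-side encoding and its freshness -/

/-- **The `ℤ³`-side encoding**: an edge query reads the designated lift at the current lift of its
explored endpoint, a column bonus reads `Dcol`. [cite: MartineauSevero2019, §5 (Steps 2K+1, 2K+2 on 𝒢)] -/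
noncomputable def encII (L : ℕ) (b : List Bool) : Query n → Finset (Sym2 (Site 3))
  | Query.edge a d => {s(lam (htOf (n := n) L b) a, lam (htOf (n := n) L b) a + dvec d)}
  | Query.col y => Dcol (stateOf (n := n) L b) (htOf (n := n) L b) y

/-- All coins read along a transcript. [cite: MartineauSevero2019, §5 (explored edges of 𝒢)] -/
noncomputable def usedOf (L : ℕ) : List Bool → Finset (Sym2 (Site 3))
  | [] => ∅
  | _ :: b => usedOf L b ∪ (match nq L (stateOf (n := n) L b) with
    | none => ∅
    | some q => encII (n := n) L b q)

/-- **What a read coin can be**: a designated lift, a vertical edge over an attempted column, or a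
horizontal edge of parity `χ` over an attempted column. [cite: MartineauSevero2019, §5 (Conditions 1–4)] -/
def Covered (b : List Bool) (E : Sym2 (Site 3)) : Prop :=
  E ∈ Desig (stateOf (n := n) L b) (htOf (n := n) L b) ∨
    (∃ y ∈ (stateOf (n := n) L b).Y, ∃ z : ℤ, E = vE y z) ∨
    (∃ y ∈ (stateOf (n := n) L b).Y, ∃ (z : ℤ) (hd : HDir), E = hE y z hd ∧ (z / n) % 2 = chi y)

/-- Designated lifts are frozen. [folklore] -/
theorem desig_cons_of_mem (a : Bool) (b : List Bool) {e : Sym2 (Vert n)} (he : e ∈ (stateOf (n := n) L b).Q) :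
    desig (stateOf (n := n) L (a :: b)) (htOf (n := n) L (a :: b)) e = desig (stateOf (n := n) L b) (htOf (n := n) L b) e := by
  have h2 := (inv_lift (n := n) L b).2 e he
  rw [desig, desig, src_cons_of_mem L a b he, lam, lam, htOf_cons_of_mem L a b h2.2]

/-- `Covered` only grows along the transcript. [folklore] -/
theorem covered_cons {a : Bool} {b : List Bool} {E : Sym2 (Site 3)} (h : Covered (n := n) L b E) : Covered (n := n) L (a :: b) E := by
  have hY := Y_subset_Y_cons (n := n) L a b
  rcases h with h | ⟨y, hy, z, rfl⟩ | ⟨y, hy, z, hd, rfl, hpar⟩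
  · left
    obtain ⟨e, he, rfl⟩ := Finset.mem_image.1 h
    exact Finset.mem_image.2 ⟨e, Q_subset_Q_cons L a b he, desig_cons_of_mem L a b he⟩
  · exact Or.inr (Or.inl ⟨y, hY hy, z, rfl⟩)
  · exact Or.inr (Or.inr ⟨y, hY hy, z, hd, rfl, hpar⟩)

/-- The base height of a column with explored base vertex is a multiple of `n`. [folklore] -/
theorem baseHt_eq (b : List Bool) {y : Site 2} (h0 : ((0 : ZMod n), y) ∈ (stateOf (n := n) L b).A) :
    baseHt (htOf (n := n) L b) y = n * kOf (htOf (n := n) L b) y := by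
  have hcast : (((baseHt (htOf (n := n) L b) y : ℤ)) : ZMod n) = 0 := (inv_lift (n := n) L b).1 _ h0
  have hdvd : (n : ℤ) ∣ baseHt (htOf (n := n) L b) y := (ZMod.intCast_zmod_eq_zero_iff_dvd _ n).1 hcast
  rw [kOf, Int.mul_ediv_cancel' hdvd]

/-- The sheet of a chosen horizontal lift has parity `χ(y)`. [folklore] -/
theorem candH_parity (b : List Bool) {y : Site 2} (h0 : ((0 : ZMod n), y) ∈ (stateOf (n := n) L b).A)
    (t : ZMod n) (hd : HDir) :
    ((baseHt (htOf (n := n) L b) y + (t.val : ℤ) + (jstar (stateOf (n := n) L b) (htOf (n := n) L b) y t hd : ℤ) * n) / n) % 2 = chi y := by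
  have hn : (0 : ℤ) < n := by exact_mod_cast Nat.pos_of_ne_zero (NeZero.ne n)
  rw [baseHt_eq L b h0]
  have : ((n : ℤ) * kOf (htOf (n := n) L b) y + (t.val : ℤ) + (jstar (stateOf (n := n) L b) (htOf (n := n) L b) y t hd : ℤ) * n) / n
      = kOf (htOf (n := n) L b) y + jstar (stateOf (n := n) L b) (htOf (n := n) L b) y t hd := by
    have hval : ((t.val : ℤ)) / n = 0 := Int.ediv_eq_zero_of_lt (by positivity) (by exact_mod_cast ZMod.val_lt t)
    rw [show (n : ℤ) * kOf (htOf (n := n) L b) y + (t.val : ℤ) + (jstar (stateOf (n := n) L b) (htOf (n := n) L b) y t hd : ℤ) * n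
      = (t.val : ℤ) + (kOf (htOf (n := n) L b) y + jstar (stateOf (n := n) L b) (htOf (n := n) L b) y t hd) * n by ring,
      Int.add_mul_ediv_right _ _ hn.ne', hval, zero_add]
  rw [this]
  exact jstar_parity _ _ y t hd

/-- A new probe is covered after the step. [folklore] -/
theorem enc_covered (a : Bool) (b : List Bool) {q : Query n} (hq : nq L (stateOf (n := n) L b) = some q)
    {E : Sym2 (Site 3)} (hE : E ∈ encII (n := n) L b q) : Covered (n := n) L (a :: b) E := by
  cases q with
  | edge a' d =>
    obtain ⟨ha', -, -⟩ := nq_edge_spec hq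
    simp only [encII, Finset.mem_singleton] at hE
    subst hE
    left
    have he : s(a', nbr a' d) ∈ (stateOf (n := n) L (a :: b)).Q := by
      rw [stateOf_cons, hq]; simp [hstep]
    refine Finset.mem_image.2 ⟨_, he, ?_⟩
    have hs : (stateOf (n := n) L (a :: b)).src s(a', nbr a' d) = (a', d) := by
      rw [stateOf_cons, hq]; simp [hstep]
    rw [desig, hs, lam, lam, htOf_cons_of_mem L a b ha']
  | col y =>
    obtain ⟨-, -, -, hopen⟩ := nq_col_spec hq
    have h0 := col_subset_A_of_colOpen L hopen 0
    have hyY : y ∈ (stateOf (n := n) L (a :: b)).Y := by rw [stateOf_cons, hq]; simp [hstep]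
    simp only [encII] at hE
    rcases Finset.mem_union.1 hE with hE | hE
    · right; left
      rcases Finset.mem_union.1 hE with hE | hE
      · obtain ⟨hS, -⟩ := Finset.mem_filter.1 hE
        obtain ⟨i, -, rfl⟩ := Finset.mem_image.1 hS
        exact ⟨y, hyY, _, rfl⟩
      · unfold D2 at hE
        split_ifs at hE with hm
        · obtain ⟨hA, -⟩ := Finset.mem_filter.1 ((Finset.exists_subset_card_eq hm).choose_spec.1 hE)
          obtain ⟨i, -, rfl⟩ := Finset.mem_image.1 hA
          exact ⟨y, hyY, _, rfl⟩
        · simp at hE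
    · right; right
      obtain ⟨⟨t, hd⟩, -, rfl⟩ := Finset.mem_image.1 hE
      exact ⟨y, hyY, _, hd, rfl, candH_parity L b h0 t hd⟩

/-- **Every read coin is covered.** [cite: MartineauSevero2019, §5 (Conditions 1–4)] -/
theorem usedOf_covered (b : List Bool) {E : Sym2 (Site 3)} (hE : E ∈ usedOf (n := n) L b) : Covered (n := n) L b E := by
  induction b with
  | nil => simp [usedOf] at hE
  | cons a b ih =>
    simp only [usedOf, Finset.mem_union] at hE
    rcases hE with hE | hE
    · exact covered_cons L (ih hE)
    · cases hq : nq L (stateOf (n := n) L b) with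
      | none => rw [hq] at hE; simp at hE
      | some q => rw [hq] at hE; exact enc_covered L a b hq hE

/-- **Freshness of an edge query**: the new designated lift was never read (it projects to the
unqueried edge, whereas every covered coin projects to a queried edge or sits over an attempted
column all of whose edges are queried). [cite: MartineauSevero2019, §5 (Condition 2)] -/
theorem fresh_edge (b : List Bool) {a : Vert n} {d : Dir} (hq : nq L (stateOf (n := n) L b) = some (Query.edge a d)) :
    ¬ Covered (n := n) L b s(lam (htOf (n := n) L b) a, lam (htOf (n := n) L b) a + dvec d) := by
  obtain ⟨ha, he, hQ⟩ := nq_edge_spec hq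
  obtain ⟨h1, h2⟩ := inv_lift (n := n) L b
  have hproj : piE n s(lam (htOf (n := n) L b) a, lam (htOf (n := n) L b) a + dvec d) = s(a, nbr a d) := by
    rw [piE_mk, pi3_add_dvec, pi3_lam (h1 a ha)]
  rintro (h | ⟨y, hy, z, hz⟩ | ⟨y, hy, z, hd, hz, -⟩)
  · obtain ⟨e, he', hde⟩ := Finset.mem_image.1 h
    have := piE_desig (h2 e he').1 (h1 _ (h2 e he').2)
    rw [hde, hproj] at this
    exact hQ (this ▸ he')
  · have := congrArg (piE n) hz
    rw [hproj, piE_vE] at this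
    exact hQ (this ▸ (inv_Y L b hy).2.1 _)
  · have := congrArg (piE n) hz
    rw [hproj, piE_hE] at this
    rw [this] at hQ he
    exact hQ ((inv_Y L b hy).2.2 _ _ he)

/-- **Freshness of a column bonus**: no coin of `Dcol` was read before (none is designated; vertical
ones live over this un-attempted column; horizontal ones have this column's parity, and a horizontal
edge of `ℤ³` shared with the probe of another column would give adjacent columns equal parity).
[cite: MartineauSevero2019, §5 (Conditions 2, 4)] -/
theorem fresh_col (b : List Bool) {y : Site 2} (hq : nq L (stateOf (n := n) L b) = some (Query.col y))
    {E : Sym2 (Site 3)} (hE : E ∈ Dcol (stateOf (n := n) L b) (htOf (n := n) L b) y) : ¬ Covered (n := n) L b E := by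
  obtain ⟨-, -, hyY, hopen⟩ := nq_col_spec hq
  have h0 := col_subset_A_of_colOpen L hopen 0
  have hπ : ∀ e ∈ (stateOf (n := n) L b).Q, piE n (desig (stateOf (n := n) L b) (htOf (n := n) L b) e) = e :=
    fun e he => piE_desig_stateOf L b he
  have hbase : (((baseHt (htOf (n := n) L b) y : ℤ)) : ZMod n) = 0 := (inv_lift (n := n) L b).1 _ h0
  -- shape of the coin
  have hshape : (∃ z : ℤ, E = vE y z) ∨ (∃ (t : ZMod n) (hd : HDir),
      E = candH (htOf (n := n) L b) y t hd (jstar (stateOf (n := n) L b) (htOf (n := n) L b) y t hd)) := by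
    rcases Finset.mem_union.1 hE with hE | hE
    · left
      rcases Finset.mem_union.1 hE with hE | hE
      · obtain ⟨hS, -⟩ := Finset.mem_filter.1 hE
        obtain ⟨i, -, rfl⟩ := Finset.mem_image.1 hS
        exact ⟨_, rfl⟩
      · unfold D2 at hE
        split_ifs at hE with hm
        · obtain ⟨hA, -⟩ := Finset.mem_filter.1 ((Finset.exists_subset_card_eq hm).choose_spec.1 hE)
          obtain ⟨i, -, rfl⟩ := Finset.mem_image.1 hA
          exact ⟨_, rfl⟩
        · simp at hE
    · right
      obtain ⟨⟨t, hd⟩, -, rfl⟩ := Finset.mem_image.1 hE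
      exact ⟨t, hd, rfl⟩
  rintro (h | ⟨y', hy', z', hz'⟩ | ⟨y', hy', z', hd', hz', hpar'⟩)
  · exact Finset.disjoint_left.1 (Dcol_disjoint_Desig _ _ y hπ hbase) hE h
  · have hne : y ≠ y' := fun h => hyY (h ▸ hy')
    rcases hshape with ⟨z, rfl⟩ | ⟨t, hd, rfl⟩
    · exact vE_ne_vE_of_ne hne z z' hz'
    · exact vE_ne_hE y' z' y _ hd (hz'.symm)
  · have hne : y ≠ y' := fun h => hyY (h ▸ hy')
    rcases hshape with ⟨z, rfl⟩ | ⟨t, hd, rfl⟩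
    · exact vE_ne_hE y z y' z' hd' hz'
    · obtain ⟨hz, hchi⟩ := hE_eq_hE hz' hne
      have hpar := candH_parity L b h0 t hd
      rw [hz] at hpar
      exact hchi (hpar.symm.trans hpar')

/-- **The `ℤ³`-side encoding is good**: probes are fresh genuine edges of `ℤ³`, one per edge query and
`8n` per bonus. [cite: MartineauSevero2019, §5 (Proposition 4.1: the coupling is well defined)] -/
theorem goodEnc_II : GoodEnc (n := n) L (8 * n) (encII (n := n) L) (zdGraph 3) := by
  refine goodEnc_of_used L (8 * n) (encII (n := n) L) (zdGraph 3) (usedOf (n := n) L) ?_ ?_ ?_ ?_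
  · intro b q hq
    cases q with
    | edge a d =>
      intro E hE
      simp only [encII, Finset.coe_singleton, Set.mem_singleton_iff] at hE
      subst hE
      exact adj_add_dvec _ _
    | col y => exact Dcol_subset_edgeSet _ _ y
  · intro b q hq
    cases q with
    | edge a d => simp [encII, qsize]
    | col y => exact card_Dcol _ _ y fun e he => piE_desig_stateOf L b he
  · intro b q a hq E hE
    simp only [usedOf, hq, Finset.mem_union] at hE ⊢
    rcases hE with hE | hE
    · exact Or.inr hE
    · exact Or.inl hE
  · intro b q hq
    rw [Finset.disjoint_left]
    intro E hE hU
    have hcov := usedOf_covered L b hU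
    cases q with
    | edge a d =>
      simp only [encII, Finset.mem_singleton] at hE
      subst hE
      exact fresh_edge L b hq hcov
    | col y => exact fresh_col L b hq hE hcov

/-! ### Consistency with the configuration and the lifted cluster -/

section Consistency

variable (ω : BondConfig (Site 3))

/-- **Consistency of a transcript with the `ℤ³` configuration**: every recorded answer is the truth
about the probed coins of `ω`. [cite: MartineauSevero2019, §5 (η := ω on p-explored lifts)] -/
def AnsOK2 : List Bool → Prop
  | [] => True
  | a :: b => AnsOK2 b ∧ match nq L (stateOf (n := n) L b) with
    | none => True
    | some q => (a = true ↔ (↑(encII (n := n) L b q) : Set (Sym2 (Site 3))) ⊆ ω)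

/-- Along a run of the `ℤ³`-side exploration, the transcript is consistent with `ω`. [cite: MartineauSevero2019, §5] -/
theorem ansOK2_bt_hist (k : ℕ) : AnsOK2 (n := n) L ω (bt ((texpl L (encII (n := n) L)).hist k ω)) := by
  induction k with
  | zero => simp [AnsOK2]
  | succ k ih =>
    have hrec := bt_hist_succ_eq (goodEnc_II (n := n) L) k ω
    cases hw : wanted L (encII (n := n) L) (bt ((texpl L (encII (n := n) L)).hist k ω)) with
    | none => rw [hw] at hrec; simp only at hrec; rw [hrec]; exact ih
    | some D =>
      rw [hw] at hrec
      simp only at hrec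
      rw [hrec]
      refine ⟨ih, ?_⟩
      unfold wanted at hw
      cases hq : nq L (stateOf (n := n) L (bt ((texpl L (encII (n := n) L)).hist k ω))) with
      | none => rw [hq] at hw; cases hw
      | some q =>
        rw [hq] at hw
        simp only [Option.map_some, Option.some.injEq] at hw
        subst hw
        simp only [decide_eq_true_eq, obs_eq_self_iff]
        rfl

variable {L ω}

/-- **The designated lift of a queried edge is open iff the edge was recorded open.**
[cite: MartineauSevero2019, §5 (η_{(e',k)} := ω_{(e,k)})] -/
theorem inv_open {b : List Bool} (hb : AnsOK2 (n := n) L ω b) :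
    ∀ e ∈ (stateOf (n := n) L b).Q, (e ∈ (stateOf (n := n) L b).O ↔ desig (stateOf (n := n) L b) (htOf (n := n) L b) e ∈ ω) := by
  induction b with
  | nil => simp [stateOf, HState.init]
  | cons a b ih =>
    obtain ⟨hb, hans⟩ := hb
    have h1 := ih hb
    obtain ⟨_, hOQ, _⟩ := inv_struct (n := n) L b
    intro e he
    have hOset : (stateOf (n := n) L (a :: b)).O = (match nq L (stateOf (n := n) L b) with
        | some (Query.edge a' d) => if a then insert s(a', nbr a' d) (stateOf (n := n) L b).O else (stateOf (n := n) L b).O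
        | _ => (stateOf (n := n) L b).O) := by
      rw [stateOf_cons]
      cases nq L (stateOf (n := n) L b) with
      | none => rfl
      | some q => cases q <;> rfl
    cases hq : nq L (stateOf (n := n) L b) with
    | none =>
      rw [hq] at hOset
      have he' : e ∈ (stateOf (n := n) L b).Q := by rwa [stateOf_cons_of_none hq] at he
      rw [hOset, desig_cons_of_mem L a b he']
      exact h1 e he'
    | some q =>
      rw [hq] at hans hOset
      cases q with
      | edge a' d =>
        obtain ⟨ha', -, hQ⟩ := nq_edge_spec hq
        simp only at hans hOset
        have hQset : (stateOf (n := n) L (a :: b)).Q = insert s(a', nbr a' d) (stateOf (n := n) L b).Q := by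
          rw [stateOf_cons, hq]; rfl
        rw [hQset] at he
        rcases Finset.mem_insert.1 he with rfl | he
        · -- the new edge
          have hs : (stateOf (n := n) L (a :: b)).src s(a', nbr a' d) = (a', d) := by
            rw [stateOf_cons, hq]; simp [hstep]
          have hd : desig (stateOf (n := n) L (a :: b)) (htOf (n := n) L (a :: b)) s(a', nbr a' d) =
              s(lam (htOf (n := n) L b) a', lam (htOf (n := n) L b) a' + dvec d) := by
            rw [desig, hs, lam, lam, htOf_cons_of_mem L a b ha']
          rw [hOset, hd]
          simp only [encII, Finset.coe_singleton, Set.singleton_subset_iff] at hans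
          split_ifs with hab
          · simp only [Finset.mem_insert, true_or, true_iff]
            exact hans.1 hab
          · constructor
            · intro h; exact absurd (hOQ h) hQ
            · intro h; exact absurd (hans.2 h) hab
        · rw [hOset, desig_cons_of_mem L a b he]
          split_ifs
          · rw [Finset.mem_insert, h1 e he, or_iff_right_iff_imp]
            rintro rfl; exact absurd he hQ
          · exact h1 e he
      | col y =>
        simp only at hOset
        have he' : e ∈ (stateOf (n := n) L b).Q := by
          have : (stateOf (n := n) L (a :: b)).Q = (stateOf (n := n) L b).Q := by rw [stateOf_cons, hq]; rfl
          rwa [this] at he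
        rw [hOset, desig_cons_of_mem L a b he']
        exact h1 e he'

omit [NeZero n] in
/-- Lifting an explored endpoint along a direction gives the lift at the next height. [folklore] -/
theorem lam_add_dvec (h : Vert n → ℤ) (a : Vert n) (d : Dir) :
    lam h a + dvec d = lft (h a + dvec d 0) (nbr a d).2 := by
  rw [lam, lft_add_dvec, nbr]

/-- **The lifted cluster** (Martineau–Severo's Condition 3, "Every element of `C'_{ℓ,n}` is connected
to `o'` by an `η`-open path", here for the lifted exploration on `ℤ³`): along a consistent
transcript, the lift of every explored vertex is joined to `0` by an `ω`-open path.
[cite: MartineauSevero2019, §5 (Condition 3; Proposition 4.1)] -/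
theorem reach_lift {b : List Bool} (hb : AnsOK2 (n := n) L ω b) :
    ∀ v ∈ (stateOf (n := n) L b).A, (openGraph ω).Reachable (0 : Site 3) (lam (htOf (n := n) L b) v) := by
  induction b with
  | nil =>
    intro v hv
    simp only [stateOf, HState.init, Finset.mem_singleton] at hv
    subst hv
    have : lam (htOf (n := n) L []) (origin n) = 0 := by
      rw [lam]; funext i; refine Fin.cases rfl (fun j => ?_) i; rfl
    rw [this]
  | cons a b ih =>
    obtain ⟨hb, hans⟩ := hb
    have hIH := ih hb
    have hfr := fun v (hv : v ∈ (stateOf (n := n) L b).A) => htOf_cons_of_mem L a b hv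
    intro v hv
    by_cases hvA : v ∈ (stateOf (n := n) L b).A
    · rw [lam, hfr v hvA]; exact hIH v hvA
    · rw [stateOf_cons] at hv
      cases hq : nq L (stateOf (n := n) L b) with
      | none => rw [hq] at hv; exact absurd hv hvA
      | some q =>
        rw [hq] at hv hans
        cases q with
        | edge a' d =>
          obtain ⟨ha', -, -⟩ := nq_edge_spec hq
          simp only [hstep] at hv
          simp only at hans
          split_ifs at hv with hab
          · rcases Finset.mem_insert.1 hv with rfl | hv
            · -- the new vertex, lifted through the open designated edge
              have hopen : s(lam (htOf (n := n) L b) a', lam (htOf (n := n) L b) a' + dvec d) ∈ ω := by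
                have := hans.1 hab
                simpa [encII] using this
              have hlam : lam (htOf (n := n) L (a :: b)) (nbr a' d) = lam (htOf (n := n) L b) a' + dvec d := by
                rw [lam_add_dvec, lam, htOf_cons, hq]
                simp [hab, hvA]
              rw [hlam]
              refine (hIH a' ha').trans (SimpleGraph.Adj.reachable ?_)
              rw [openGraph_adj]
              exact ⟨hopen, (adj_add_dvec _ _).ne⟩
            · exact absurd hv hvA
          · exact absurd hv hvA
        | col y =>
          obtain ⟨-, -, -, hcolopen⟩ := nq_col_spec hq
          simp only [hstep] at hv
          simp only at hans
          split_ifs at hv with hab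
          · rcases Finset.mem_union.1 hv with hv | hv
            · exact absurd hv hvA
            · -- a vertex conquered by the bonus
              have hD : (↑(Dcol (stateOf (n := n) L b) (htOf (n := n) L b) y) : Set (Sym2 (Site 3))) ⊆ ω := by
                have := hans.1 hab
                simpa [encII] using this
              have hadj := mem_nbhdVerts_iff.1 hv
              set h := htOf (n := n) L b with hh
              set σ := stateOf (n := n) L b with hσ
              have h0 : ((0 : ZMod n), y) ∈ σ.A := col_subset_A_of_colOpen L hcolopen 0
              have hπ : ∀ e ∈ σ.Q, piE n (desig σ h e) = e := fun e he => piE_desig_stateOf L b he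
              -- all vertical edges of the witness are open
              have hseg : ∀ i : ℕ, i < 4 * n → vE y (baseHt h y + i) ∈ ω := by
                intro i hi
                have hS : vE y (baseHt h y + i) ∈ Seg h y := Finset.mem_image.2 ⟨i, Finset.mem_range.2 hi, rfl⟩
                by_cases hdes : vE y (baseHt h y + i) ∈ Desig σ h
                · obtain ⟨e, he, hde⟩ := Finset.mem_image.1 hdes
                  have heO : e ∈ σ.O := by
                    rw [← hπ e he, hde, piE_vE]
                    exact hcolopen _
                  rw [← hde]
                  exact ((inv_open hb) e he).1 heO
                · exact hD (Finset.mem_union_left _ (Finset.mem_union_left _ (Finset.mem_filter.2 ⟨hS, hdes⟩)))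
              -- hence every vertex of the witness is reached
              have hclimb : ∀ i : ℕ, i ≤ 4 * n → (openGraph ω).Reachable (0 : Site 3) (lft (baseHt h y + i) y) := by
                intro i hi
                induction i with
                | zero =>
                  have := hIH _ h0
                  rw [lam] at this
                  simpa [baseHt] using this
                | succ i ihi =>
                  refine (ihi (by omega)).trans (SimpleGraph.Adj.reachable ?_)
                  rw [openGraph_adj]
                  refine ⟨?_, fun heq => ?_⟩
                  · have := hseg i (by omega)
                    rw [vE] at this
                    push_cast
                    rwa [← add_assoc]
                  · have := (lft_eq_lft_iff.1 heq).1
                    push_cast at this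
                    omega
              -- the chosen horizontal lift
              set t := v.1 with ht
              set hd := hdOf y v.2 with hhd
              set j := jstar σ h y t hd with hj
              have hjle : j ≤ 3 := jstar_le σ h y t hd
              set i₀ : ℕ := t.val + j * n with hi₀
              have hi₀le : i₀ ≤ 4 * n := by
                have := ZMod.val_lt t
                have : j * n ≤ 3 * n := Nat.mul_le_mul_right _ hjle
                omega
              have hx := hclimb i₀ hi₀le
              have hcand : candH h y t hd j ∈ ω := by
                refine hD (Finset.mem_union_right _ (Finset.mem_image.2 ⟨(t, hd), Finset.mem_product.2 ⟨Finset.mem_univ _, Finset.mem_univ _⟩, ?_⟩))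
                rfl
              have hlamv : lam (htOf (n := n) L (a :: b)) v = lft (baseHt h y + i₀) y + dvec (hdir hd) := by
                rw [lam, htOf_cons, hq]
                simp only [hab, if_true, bonusHt, hvA, if_false, hadj, ← hσ, ← hh]
                rw [lft_add_dvec, (dvec_hdir hd).1, add_zero, ← hdOf_spec hadj, hi₀]
                congr 1
                simp only [← ht, ← hhd, ← hj]
                push_cast
                ring
              rw [hlamv]
              refine hx.trans (SimpleGraph.Adj.reachable ?_)
              rw [openGraph_adj]
              refine ⟨?_, (adj_add_dvec _ _).ne⟩
              have : candH h y t hd j = s(lft (baseHt h y + i₀) y, lft (baseHt h y + i₀) y + dvec (hdir hd)) := by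
                rw [candH, hE, hi₀]; push_cast; ring_nf
              rw [← this]
              exact hcand
          · exact absurd hv hvA

/-- The event that the open cluster of `0` in `ℤ³` contains a point over a column of sup-norm `L + 1`.
[cite: MartineauSevero2019, §4 (proof of Thm 2.1: "π(𝒞_𝒢^p(o')) is infinite")] -/
def FarEv (L : ℕ) : Set (BondConfig (Site 3)) :=
  {ω | ∃ x : Site 3, (openGraph ω).Reachable 0 x ∧ pnorm (tail3 x) = L + 1}

/-- **Proposition 4.1 on events**: along the `ℤ³`-side run, if a column of sup-norm `L + 1` was
explored then the open cluster of `0` reaches over such a column. [cite: MartineauSevero2019, §4 (Proposition 4.1)] -/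
theorem setOf_reachState_subset_far (L k : ℕ) :
    {ω : BondConfig (Site 3) | ReachState L (stateOf (n := n) L (bt ((texpl L (encII (n := n) L)).hist k ω)))} ⊆ FarEv L := by
  intro ω hω
  obtain ⟨v, hv, hvL⟩ := hω
  refine ⟨_, reach_lift (ansOK2_bt_hist L ω k) v hv, ?_⟩
  rw [lam, tail3_lft]
  exact hvL

end Consistency

end SlabTorus

end Literature.Probability.Percolation
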